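import Literature.Topology.FourManifolds.ThetaFourKervaireMilnor
import Literature.Topology.FourManifolds.PontryaginThomCollapse
import HarnessLib

/-!
# `Π₄ = 0` on the Pontryagin–Thom collapse: Kervaire–Milnor's §4 at `n = 4` reduced to its leaves

Topic `Literature/Topology/FourManifolds`; second layer under the named fact
`Literature.Topology.FourManifolds.isHCobordant_sphere_of_homotopySphere_four` (`Θ₄ = 0`,
`ThetaFour.lean`), below the leaf
`Literature.Topology.FourManifolds.HomotopySphere.boundsParallelizable_of_isStablyParallelizable_four`
of `ThetaFourKervaireMilnor.lean` (Kervaire–Milnor, *Groups of homotopy spheres I*, Ann. of Math.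
77 (1963), §4 for `n = 4`: an s-parallelizable homotopy 4-sphere bounds a parallelizable manifold,
because `Π₄ = 0`). Exactly as `PontryaginThomCollapse.lean` does for `n = 7`
(`HomotopySphere.boundsParallelizable_of_isStablyParallelizable_seven_of`), that leaf is **proved**
here from the general leaves of that file,

* (a) `exists_isSmoothEmbedding_isNormalFraming_of_isStablyParallelizable` — p. 510, first
  paragraph: an s-parallelizable closed `Mⁿ` embeds in `Sⁿ⁺ᵏ`, `k > n + 1`, with a normal
  framing (Whitney; Lemma 3.3), whence, by the tree's tubular neighbourhood theorem
  (`FramedTubularNbhd.lean`), a framed tubular embedding with its collapse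
  `p(M, φ) : Sⁿ⁺ᵏ → Sᵏ = ℝᵏ ∪ {∞}` (`FramedTubularEmbedding.collapse`);
* (b) `boundsParallelizable_of_collapseNullHomotopic` — Lemma 4.2, `⇒`: if `p(M, φ) ≃ 0` then
  `M` bounds a parallelizable manifold (Thom transversality, Lemmas 3.3–3.4),

and the one dimension-specific input, vendored here as a named fact:

* `piStable_four_trivial` — **`Π₄ = 0`**: the stable stem `Π₄ = π₄₊ₖ(Sᵏ)`, `k > 5`, vanishes
  (p. 510: "the stable homotopy group `Πₙ = πₙ₊ₖ(Sᵏ)`"; table p. 512, column `n = 4`), read on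
  the carrier of the collapse maps: every continuous `S⁴⁺ᵏ → ℝᵏ ∪ {∞}`, `k > 5`, is
  null-homotopic. For `n = 7` the corresponding input (c) of `PontryaginThomCollapse.lean` is
  `0 ∈ p(Σ)` (coker `J₇ = 0`); for `n = 4` the whole group vanishes, so no `J`-homomorphism or
  Lemma 4.5 is needed and the statement holds for every closed 4-manifold.

## Proved here

* `collapseNullHomotopic_of_piStable_four`: `p(M, φ) ≃ 0` for every framed tubular embedding of a
  compact `4`-dimensional `M` in `S⁴⁺ᵏ`, `k > 5`.
* `boundsParallelizable_of_isStablyParallelizable_of_piStable_four`: **every s-parallelizable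
  closed 4-manifold bounds a parallelizable manifold** (Lemma 4.2 with `Π₄ = 0`, p. 510), GIVEN
  (a), (b), `Π₄ = 0`.
* `HomotopySphere.boundsParallelizable_of_isStablyParallelizable_four_of`: the leaf of
  `ThetaFourKervaireMilnor.lean` from (a), (b), `Π₄ = 0`.
* `isHCobordant_sphere_of_homotopySphere_four_of_collapseLeaves`: `Θ₄ = 0` from the refined leaf
  set — (2.3b) `NullCobordism.isHomotopyEquiv_compl_ball_of_contractibleSpace`, (3.1)
  `HomotopySphere.isStablyParallelizable`, (a), (b), `Π₄ = 0`, and (5.1, `k = 2`)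
  `HomotopySphere.boundsContractible_of_nullCobordism_isStablyParallelizable_four` — through
  `isHCobordant_sphere_of_homotopySphere_four_of_leaves`.

Nothing is discharged: (a), (b), `Π₄ = 0`, (2.3b), (3.1), (5.1) are theories absent from Mathlib
and from the tree (Whitney embedding and obstruction theory; transversality; the computation of
`π₄₊ₖ(Sᵏ)`, Serre 1951–53 / Toda; Whitehead's theorem and duality; surgery).

Faithfulness. `Π₄ = 0` is printed as the value of the stable group `Π₄ = π₄₊ₖ(Sᵏ)`, `k > n + 1 = 5`
(p. 510 and table p. 512); a based null-homotopy of a map `S⁴⁺ᵏ → Sᵏ` is in particular a free one,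
so "every continuous map `S⁴⁺ᵏ → Sᵏ` is freely null-homotopic" follows from the printed statement
(and is equivalent to it, `Sᵏ` being simply connected for `k ≥ 2`). The target `Sᵏ` is modelled as
`OnePoint ℝᵏ`, as in `FramedTubularEmbedding.collapse` (Kosinski IX §5: `Sᵏ = ℝᵏ ∪ {a₋}`;
Mathlib's `onePointEquivSphereOfFinrankEq`). Manifolds in the proved statements are closed
(compact Hausdorff second-countable `C^∞`, modelled on `ℝ⁴`) and live in `Type`, as in (a), (b).

## References

* M. Kervaire, J. Milnor, *Groups of homotopy spheres I*, Ann. of Math. (2) 77 (1963), 504–537: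
  §3, Lemmas 3.3–3.4 (p. 509); §4, p. 510 (the embedding, `p(M, φ)`, `Πₙ = πₙ₊ₖ(Sᵏ)`), Lemma 4.2
  (p. 510), proof of Thm. 4.1, Remarks and table p. 512 (`Π₄ = 0`). doi:10.2307/1970128
  [KervaireMilnorAnnals1963]
* A. Kosinski, *Differential Manifolds* (1993), Ch. IX §5 (the Pontriagin construction `p(V, t)`,
  (5.2)–(5.5)). [Kosinski1993]
-/

noncomputable section

open scoped Manifold ContDiff

namespace Literature.Topology.FourManifolds

/-- Local notation: `𝔼 n` is the model Euclidean space `EuclideanSpace ℝ (Fin n)`. -/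
local notation "𝔼 " n:arg => EuclideanSpace ℝ (Fin n)

/-- Local notation: `𝕊 n` is the unit sphere in `EuclideanSpace ℝ (Fin (n + 1))`. -/
local notation "𝕊 " n:arg => (Metric.sphere (0 : EuclideanSpace ℝ (Fin (n + 1))) 1)

/-! ### The named fact `Π₄ = 0` -/

/-- **`Π₄ = 0`** (named fact): the stable `4`-stem `Π₄ = π₄₊ₖ(Sᵏ)`, `k > 5`, vanishes —
Kervaire–Milnor, *Groups of homotopy spheres I* (1963), §4, p. 510 ("The homotopy class of
`p(M, φ)` is a well defined element of the stable homotopy group `Πₙ = πₙ₊ₖ(Sᵏ)`", `k > n + 1`)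
and the table of `Πₙ`, `p(Sⁿ)`, `Πₙ / p(Sⁿ)` for `n ≤ 8` on p. 512 (Remarks after the proof of
Thm. 4.1), column `n = 4`: `Π₄ = 0` (finite by Serre, p. 512; computed by Serre's method, Toda).
Stated on the carrier of the tree's Pontryagin–Thom collapse maps
(`FramedTubularEmbedding.collapse : C(𝕊⁴⁺ᵏ, ℝᵏ ∪ {∞})`, `PontryaginThomCollapse.lean`, with
`Sᵏ = OnePoint ℝᵏ`): every continuous map `S⁴⁺ᵏ → ℝᵏ ∪ {∞}`, `k > 5`, is (freely) homotopic to
the constant map `∞` — which follows from `π₄₊ₖ(Sᵏ) = 0`, a based null-homotopy being a free one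
(and is equivalent to it, `Sᵏ` being simply connected). Not proved here: no homotopy group of a
sphere beyond `π₁` is computed in Mathlib or in the tree.
[cite: KervaireMilnorAnnals1963, §4, p. 510 (Πₙ = πₙ₊ₖ(Sᵏ), k > n + 1) and table p. 512 (Π₄ = 0)] -/
def piStable_four_trivial : Prop :=
  ∀ (k : ℕ), 5 < k → ∀ f : C((𝕊 (4 + k)), OnePoint (𝔼 k)),
    f.Homotopic (ContinuousMap.const _ OnePoint.infty)

/-! ### §4 at `n = 4` from (a), (b) and `Π₄ = 0` -/

/-- GIVEN `Π₄ = 0` (`piStable_four_trivial`), the Pontryagin–Thom collapse `p(M, φ)` of every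
framed tubular embedding `M × ℝᵏ ↪ S⁴⁺ᵏ`, `k > 5`, of a compact `4`-dimensional `M` is
null-homotopic (`FramedTubularEmbedding.CollapseNullHomotopic`): `p(M) ⊂ Π₄ = 0`
(Kervaire–Milnor 1963, p. 510 and table p. 512). [cite: KervaireMilnorAnnals1963, §4, p. 510 and table p. 512] -/
theorem collapseNullHomotopic_of_piStable_four (hPi : piStable_four_trivial) {k : ℕ} (hk : 5 < k)
    {M : Type*} [TopologicalSpace M] [CompactSpace M] [ChartedSpace (𝔼 4) M]
    (E : FramedTubularEmbedding 4 k M) : E.CollapseNullHomotopic :=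
  hPi k hk E.collapse

/-- **Lemma 4.2 with `Π₄ = 0`: every s-parallelizable closed `4`-manifold bounds a parallelizable
manifold**, GIVEN (a) the normally framed embedding `M⁴ ↪ S⁴⁺ᵏ`, `k > 5`
(`exists_isSmoothEmbedding_isNormalFraming_of_isStablyParallelizable`; p. 510 with Lemma 3.3),
the tree's tubular neighbourhood theorem (`nonempty_framedTubularEmbedding_of_isStablyParallelizable`),
`Π₄ = 0` (`piStable_four_trivial`, so that `p(M, φ) ≃ 0`) and (b) Lemma 4.2, `⇒`
(`boundsParallelizable_of_collapseNullHomotopic`). Kervaire–Milnor 1963, p. 510: "Given an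
s-parallelizable closed manifold `M` of dimension `n`, choose an imbedding `i : M → Sⁿ⁺ᵏ` with
`k > n + 1` …" and Lemma 4.2: "The subset `p(M) ⊂ Πₙ` contains the zero element of `Πₙ` if and only
if `M` bounds a parallelizable manifold." Here `k = 6`.
[cite: KervaireMilnorAnnals1963, §4, p. 510, Lemma 4.2 and table p. 512 (Π₄ = 0)] -/
theorem boundsParallelizable_of_isStablyParallelizable_of_piStable_four
    (ha : exists_isSmoothEmbedding_isNormalFraming_of_isStablyParallelizable)
    (hb : boundsParallelizable_of_collapseNullHomotopic) (hPi : piStable_four_trivial)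
    (M : Type) [TopologicalSpace M] [T2Space M] [SecondCountableTopology M] [CompactSpace M]
    [ChartedSpace (𝔼 4) M] [IsManifold (𝓡 4) ∞ M] (hM : IsStablyParallelizable (𝓡 4) M) :
    BoundsParallelizable 4 M := by
  obtain ⟨E⟩ := nonempty_framedTubularEmbedding_of_isStablyParallelizable ha M hM
    (k := 6) (by norm_num)
  exact hb 4 6 M E (by norm_num) (collapseNullHomotopic_of_piStable_four hPi (by norm_num) E)

/-- **Kervaire–Milnor's §4 at `n = 4` from its printed ingredients**: the named fact
`HomotopySphere.boundsParallelizable_of_isStablyParallelizable_four` (`ThetaFourKervaireMilnor.lean`: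
an s-parallelizable homotopy 4-sphere bounds a parallelizable manifold) holds GIVEN (a), (b) and
`Π₄ = 0` — the `n = 4` counterpart of
`HomotopySphere.boundsParallelizable_of_isStablyParallelizable_seven_of` (`PontryaginThomCollapse.lean`),
with (c) there (`0 ∈ p(Σ)`, coker `J₇ = 0`) replaced by the vanishing of the whole group `Π₄`.
[cite: KervaireMilnorAnnals1963, §4, pp. 510–512 (proof of Thm. 4.1, Lemma 4.2, table: Π₄ = 0)] -/
theorem HomotopySphere.boundsParallelizable_of_isStablyParallelizable_four_of
    (ha : exists_isSmoothEmbedding_isNormalFraming_of_isStablyParallelizable)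
    (hb : boundsParallelizable_of_collapseNullHomotopic) (hPi : piStable_four_trivial) :
    HomotopySphere.boundsParallelizable_of_isStablyParallelizable_four :=
  fun S hS => boundsParallelizable_of_isStablyParallelizable_of_piStable_four ha hb hPi S.carrier hS

/-! ### `Θ₄ = 0` over the refined leaves -/

/-- **`Θ₄ = 0` from the refined leaves.** Every homotopy `4`-sphere is h-cobordant to `S⁴`
(`isHCobordant_sphere_of_homotopySphere_four`) GIVEN (2.3b) the homotopy theory in Lemma 2.3
(`NullCobordism.isHomotopyEquiv_compl_ball_of_contractibleSpace`), (3.1) Thm. 3.1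
(`HomotopySphere.isStablyParallelizable`), (a) the normally framed embedding, (b) Lemma 4.2 `⇒`,
`Π₄ = 0`, and (5.1) Thm. 5.1 at `k = 2`
(`HomotopySphere.boundsContractible_of_nullCobordism_isStablyParallelizable_four`) — the assembly
`isHCobordant_sphere_of_homotopySphere_four_of_leaves` of `ThetaFourKervaireMilnor.lean` with its
§4 leaf fed by `HomotopySphere.boundsParallelizable_of_isStablyParallelizable_four_of`.
[cite: KervaireMilnorAnnals1963, Thm. 1.1 for n = 4: Lemma 2.3, Thm. 3.1, §4 (p. 510, Lemma 4.2, table p. 512), Thm. 5.1] -/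
theorem isHCobordant_sphere_of_homotopySphere_four_of_collapseLeaves
    (h23b : NullCobordism.isHomotopyEquiv_compl_ball_of_contractibleSpace)
    (h31 : HomotopySphere.isStablyParallelizable)
    (ha : exists_isSmoothEmbedding_isNormalFraming_of_isStablyParallelizable)
    (hb : boundsParallelizable_of_collapseNullHomotopic) (hPi : piStable_four_trivial)
    (h51 : HomotopySphere.boundsContractible_of_nullCobordism_isStablyParallelizable_four) :
    isHCobordant_sphere_of_homotopySphere_four :=
  isHCobordant_sphere_of_homotopySphere_four_of_leaves h23b h31
    (HomotopySphere.boundsParallelizable_of_isStablyParallelizable_four_of ha hb hPi) h51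

end Literature.Topology.FourManifolds

end
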